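import Summits.AtomisticToContinuum.Crystallization.Theses.ChessboardParticlePlanes

/-!
# Crux `PeriodicWindows` (stmt-AtomisticToContinuum-3240), line `Sketch` — stub `stub_mirrorPeriodTwo`

Geometric step of the lead skeleton `PeriodicWindowsSketch` (pure one-dimensional geometry, no
physics): a relatively dense, exactly laminar point set `X' ⊆ ℝ³` that is mirror-symmetric
through the horizontal plane of each of its points is a period-2 stack: all occupied heights lie
in `t + hℤ` with `h ≥ 3/4`, and `X'` is invariant under the vertical translations `± 2h • e₃`.

Proof. Work with the set `H ⊆ ℝ` of occupied heights: it is `ρ`-dense, `3/4`-separated and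
symmetric about each of its elements (`t, s ∈ H → 2t - s ∈ H`). Pick `t₀ ∈ H` and let `t₁` be
the least element of `H` above `t₀` (a separated subset of a bounded interval is finite, by the
injection `t ↦ ⌊t / (3/4)⌋`); put `h := t₁ - t₀ ≥ 3/4`, so that no element of `H` lies strictly
between `t₀` and `t₀ + h`. A two-step reflection recursion gives `t₀ + hℤ ⊆ H`; composing two
reflections gives invariance of `H` under `± 2h`, which reduces any `s ∈ H` into `[t₀, t₀ + 2h)`,
where minimality of `t₁` (directly, or after reflecting about `t₁`) leaves only
`s ∈ {t₀, t₀ + h}`. Finally the vertical translates `p ± 2h • e₃` of a point `p ∈ X'` are the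
mirror images of `p` through the occupied planes at heights `p 2 ± h`.
-/

noncomputable section

namespace Summit.AtomisticToContinuum.Crystallization.Theorems.PeriodicWindowsSketch

open Literature.MathematicalPhysics.StatisticalMechanics Filter

/-- A `3/4`-separated set of reals meets every bounded interval in a finite set
(inject it into `ℤ` by `t ↦ ⌊t / (3/4)⌋`). -/
private theorem finite_inter_Icc_of_sep (H : Set ℝ)
    (hsep : ∀ t ∈ H, ∀ s ∈ H, t ≠ s → (3 : ℝ) / 4 ≤ |t - s|) (a b : ℝ) :
    (H ∩ Set.Icc a b).Finite := by
  have hinj : Set.InjOn (fun t : ℝ => ⌊t / (3 / 4)⌋) H := by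
    intro t ht s hs hts
    by_contra hne
    have h1 : |t / (3 / 4) - s / (3 / 4)| < 1 := Int.abs_sub_lt_one_of_floor_eq_floor hts
    have h2 := hsep t ht s hs hne
    rw [← sub_div, abs_div, abs_of_pos (by norm_num : (0 : ℝ) < 3 / 4),
      div_lt_one (by norm_num : (0 : ℝ) < 3 / 4)] at h1
    linarith
  refine Set.Finite.of_finite_image ?_ (hinj.mono Set.inter_subset_left)
  refine (Set.finite_Icc ⌊a / (3 / 4)⌋ ⌊b / (3 / 4)⌋).subset ?_
  rintro _ ⟨t, ⟨-, hta, htb⟩, rfl⟩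
  exact ⟨Int.floor_le_floor (div_le_div_of_nonneg_right hta (by norm_num)),
    Int.floor_le_floor (div_le_div_of_nonneg_right htb (by norm_num))⟩

/-- One-dimensional core: a relatively dense, `3/4`-separated set of reals that is symmetric about
each of its elements is the arithmetic progression `t₀ + hℤ` for some `t₀` and some `h ≥ 3/4`. -/
private theorem progression_of_dense_sep_symm (H : Set ℝ) (ρ : ℝ)
    (hdense : ∀ z : ℝ, ∃ t ∈ H, |t - z| ≤ ρ)
    (hsep : ∀ t ∈ H, ∀ s ∈ H, t ≠ s → (3 : ℝ) / 4 ≤ |t - s|)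
    (hsymm : ∀ t ∈ H, ∀ s ∈ H, 2 * t - s ∈ H) :
    ∃ t₀ h : ℝ, (3 : ℝ) / 4 ≤ h ∧ (∀ k : ℤ, t₀ + h * (k : ℝ) ∈ H) ∧
      ∀ s ∈ H, ∃ k : ℤ, s = t₀ + h * (k : ℝ) := by
  obtain ⟨t₀, ht₀, -⟩ := hdense 0
  -- the elements of `H` in `(t₀, t₀ + 2ρ + 1]` form a finite nonempty set `S`
  set S : Set ℝ := H ∩ Set.Ioc t₀ (t₀ + 2 * ρ + 1) with hS
  have hSfin : S.Finite :=
    (finite_inter_Icc_of_sep H hsep t₀ (t₀ + 2 * ρ + 1)).subset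
      (Set.inter_subset_inter_right _ Set.Ioc_subset_Icc_self)
  have hSne : S.Nonempty := by
    obtain ⟨t, ht, htz⟩ := hdense (t₀ + ρ + 1 / 2)
    rw [abs_le] at htz
    exact ⟨t, ht, by linarith, by linarith⟩
  -- its least element `t₁` defines the period `h := t₁ - t₀`
  obtain ⟨t₁, ⟨ht₁H, ht₁gt, ht₁le⟩, ht₁min⟩ := Set.exists_min_image S id hSfin hSne
  set h : ℝ := t₁ - t₀ with hh
  have hh34 : (3 : ℝ) / 4 ≤ h := by
    have h1 := hsep t₁ ht₁H t₀ ht₀ (ne_of_gt ht₁gt)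
    rwa [abs_of_pos (sub_pos.2 ht₁gt)] at h1
  have hpos : 0 < h := by linarith
  -- KEY: no element of `H` lies strictly between `t₀` and `t₀ + h = t₁`
  have hkey : ∀ s ∈ H, t₀ < s → s < t₀ + h → False := by
    intro s hs hs1 hs2
    have h1 : t₁ ≤ s := ht₁min s ⟨hs, hs1, by linarith⟩
    linarith
  -- Claim A: every lattice height `t₀ + h k` occurs (two-step reflection recursion)
  have hA : ∀ k : ℤ, t₀ + h * (k : ℝ) ∈ H ∧ t₀ + h * ((k : ℝ) + 1) ∈ H := by
    intro k
    induction k with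
    | zero =>
      refine ⟨by simpa using ht₀, ?_⟩
      convert ht₁H using 1
      push_cast
      linarith
    | succ i ih =>
      refine ⟨by exact_mod_cast ih.2, ?_⟩
      convert hsymm _ ih.2 _ ih.1 using 1
      push_cast
      ring
    | pred i ih =>
      refine ⟨?_, ?_⟩
      · convert hsymm _ ih.1 _ ih.2 using 1
        push_cast
        ring
      · convert ih.1 using 1
        push_cast
        ring
  -- translation invariance of `H` by `2 h ℤ` (compose the reflections about `t₀` and `t₁`)
  have hT : ∀ j : ℤ, ∀ s ∈ H, s + 2 * h * (j : ℝ) ∈ H := by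
    intro j
    induction j with
    | zero => intro s hs; simpa using hs
    | succ i ih =>
      intro s hs
      convert hsymm t₁ ht₁H _ (hsymm t₀ ht₀ _ (ih s hs)) using 1
      push_cast
      linarith
    | pred i ih =>
      intro s hs
      convert hsymm t₀ ht₀ _ (hsymm t₁ ht₁H _ (ih s hs)) using 1
      push_cast
      linarith
  refine ⟨t₀, h, hh34, fun k => (hA k).1, fun s hs => ?_⟩
  -- Claim B: reduce `s ∈ H` into `[t₀, t₀ + 2h)` by a translation in `2 h ℤ`
  set j : ℤ := ⌊(s - t₀) / (2 * h)⌋ with hj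
  have h2h : 0 < 2 * h := by linarith
  have hj1 : (j : ℝ) * (2 * h) ≤ s - t₀ := (le_div_iff₀ h2h).1 (Int.floor_le _)
  have hj2 : s - t₀ < ((j : ℝ) + 1) * (2 * h) := (div_lt_iff₀ h2h).1 (Int.lt_floor_add_one _)
  have hs' : s - 2 * h * (j : ℝ) ∈ H := by
    convert hT (-j) s hs using 1
    push_cast
    ring
  have hlow : t₀ ≤ s - 2 * h * (j : ℝ) := by linarith
  have hup : s - 2 * h * (j : ℝ) < t₀ + 2 * h := by linarith
  rcases eq_or_lt_of_le hlow with heq | hgt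
  · exact ⟨2 * j, by push_cast; linarith⟩
  rcases lt_trichotomy (s - 2 * h * (j : ℝ)) (t₀ + h) with hlt' | heq' | hgt'
  · exact (hkey _ hs' hgt hlt').elim
  · exact ⟨2 * j + 1, by push_cast; linarith⟩
  · -- reflect about `t₁ = t₀ + h`: the image lies strictly between `t₀` and `t₀ + h`
    exact (hkey _ (hsymm t₁ ht₁H _ hs') (by linarith) (by linarith)).elim

/-- STUB (geometry): a relatively dense, exactly laminar point set `X' ⊆ ℝ³` which is
mirror-symmetric through the horizontal plane of each of its points is a period-2 stack: all
heights lie in `t + hℤ` with `h ≥ 3/4`, and `X'` is invariant under `± 2h • e₃`. -/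
theorem stub_mirrorPeriodTwo (X' : Set (EuclideanSpace ℝ (Fin 3)))
    (hdense : ∃ ρ₁ : ℝ, ∀ c : EuclideanSpace ℝ (Fin 3), ∃ p ∈ X', dist p c ≤ ρ₁)
    (hlam : ∀ p ∈ X', ∀ q ∈ X', p 2 ≠ q 2 → (3 : ℝ) / 4 ≤ |p 2 - q 2|)
    (hmirror : ∀ p ∈ X', ∀ q ∈ X',
      q - (2 * (q 2 - p 2)) • EuclideanSpace.single (2 : Fin 3) (1 : ℝ) ∈ X') :
    ∃ t h : ℝ, (3 : ℝ) / 4 ≤ h ∧ (∀ p ∈ X', ∃ k : ℤ, p 2 = t + h * (k : ℝ)) ∧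
      (∀ p ∈ X', p + (2 * h) • EuclideanSpace.single (2 : Fin 3) (1 : ℝ) ∈ X' ∧
        p - (2 * h) • EuclideanSpace.single (2 : Fin 3) (1 : ℝ) ∈ X') := by
  obtain ⟨ρ₁, hρ₁⟩ := hdense
  -- the set `H` of occupied heights is dense, separated and symmetric about each of its elements
  have hHdense : ∀ z : ℝ, ∃ t ∈ {t : ℝ | ∃ p ∈ X', p 2 = t}, |t - z| ≤ ρ₁ := by
    intro z
    obtain ⟨p, hp, hpc⟩ := hρ₁ (EuclideanSpace.single (2 : Fin 3) z)
    refine ⟨p 2, ⟨p, hp, rfl⟩, ?_⟩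
    have h1 := PiLp.dist_apply_le p (EuclideanSpace.single (2 : Fin 3) z) 2
    rw [Real.dist_eq, PiLp.single_eq_same] at h1
    exact h1.trans hpc
  have hHsep : ∀ t ∈ {t : ℝ | ∃ p ∈ X', p 2 = t}, ∀ s ∈ {t : ℝ | ∃ p ∈ X', p 2 = t},
      t ≠ s → (3 : ℝ) / 4 ≤ |t - s| := by
    rintro _ ⟨p, hp, rfl⟩ _ ⟨q, hq, rfl⟩ hne
    exact hlam p hp q hq hne
  have hHsymm : ∀ t ∈ {t : ℝ | ∃ p ∈ X', p 2 = t}, ∀ s ∈ {t : ℝ | ∃ p ∈ X', p 2 = t},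
      2 * t - s ∈ {t : ℝ | ∃ p ∈ X', p 2 = t} := by
    rintro _ ⟨p, hp, rfl⟩ _ ⟨q, hq, rfl⟩
    refine ⟨_, hmirror p hp q hq, ?_⟩
    rw [PiLp.sub_apply, PiLp.smul_apply, PiLp.single_eq_same, smul_eq_mul]
    ring
  obtain ⟨t₀, h, hh34, hA, hB⟩ :=
    progression_of_dense_sep_symm {t : ℝ | ∃ p ∈ X', p 2 = t} ρ₁ hHdense hHsep hHsymm
  refine ⟨t₀, h, hh34, fun p hp => hB (p 2) ⟨p, hp, rfl⟩, fun p hp => ?_⟩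
  obtain ⟨k, hk⟩ := hB (p 2) ⟨p, hp, rfl⟩
  -- the planes at heights `p 2 ± h` are occupied; reflect `p` through them
  obtain ⟨q, hq, hq2⟩ := hA (k + 1)
  obtain ⟨r, hr, hr2⟩ := hA (k - 1)
  constructor
  · have h1 := hmirror q hq p hp
    have h2 : 2 * (p 2 - q 2) = -(2 * h) := by
      rw [hk, hq2]
      push_cast
      ring
    rwa [h2, neg_smul, sub_neg_eq_add] at h1
  · have h1 := hmirror r hr p hp
    have h2 : 2 * (p 2 - r 2) = 2 * h := by
      rw [hk, hr2]
      push_cast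
      ring
    rwa [h2] at h1

end Summit.AtomisticToContinuum.Crystallization.Theorems.PeriodicWindowsSketch

end
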